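import Literature.Geometry.Lorentzian.ADMTailCoefficientClass
import Literature.Geometry.Lorentzian.ExteriorTailHolderDecay
import HarnessLib

/-!
# Pointwise consequences of the tail coefficient class (Ellithy 2026, Definition 3.6 with Lemma 3.3)

A. Ellithy, *The spacetime Penrose inequality under a quasi final state hypothesis*,
arXiv:2605.18730 (2026), §3.1: Definition 3.6 (p. 21), Definition 3.2 and Lemma 3.3 (p. 20).

For a tuple `𝒮 = (N, λ, β, b, γ) ∈ 𝒞𝒮_{-τ}(ℳ)` (`ADMTailTuple.IsTailCoeff`,
`Literature.Geometry.Lorentzian.ADMTailCoefficientClass`) the class is "controlled by a family of tail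
norms, one for each `r₁ > r₀`" (Def. 3.6, p. 21): (i) `𝒩_τ(r₁) < ∞` — in particular (the `j = 0`
summands) `sup_{t > T̲} ‖(N-1)(t)‖_{C^{2+α,1+α/2}_{-τ}(M_{r₁,∞})}`, and likewise for `λ - 1`, `b`, `β`,
`r⁻²γ - γ_{S²}`, are finite; (ii) `δ_*⁻¹ ≥ λ ≥ δ_*`, `ϑ_*⁻¹ ≥ N + |β^T|²_γ ≥ N ≥ ϑ_*`,
`c_*⁻¹ ≥ r H ≥ c_*` with `t`-independent positive constants.  Since "the notation `C_{-σ}` corresponds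
to decay like `r^{-σ}`" (Def. 3.2, p. 20) and `r^σ v ∈ C⁰` for `v ∈ C_{-σ}` (Lemma 3.3, p. 20;
`Literature.Geometry.Lorentzian.ExteriorTailHolderDecay`), this module records the POINTWISE,
UNIFORM-IN-`t` form of (i) and unpacks (ii):

* `ADMTailTuple.IsTailCoeff.pointwise_decay` — for every `r₁ > r₀ ≥ 0` there is `C ≥ 0` with
  `|N - 1|, |λ - 1|, ‖b‖, ‖(β_r, β^T)‖, ‖r⁻²γ(Π·,Π·) - γ_{S²}‖ ≤ C r^{-τ}` at every `t > T̲`, `r > r₁`,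
  `p ∈ S²`;
* `ADMTailTuple.IsTailCoeff.lapse_bounds` / `.lam_bounds` / `.meanCurv_bounds` — the constants of (ii);
* `ADMTailTuple.admForm_apply_dt_dt` — the `dt ⊗ dt` coefficient of the ADM form:
  `g(∂_t, ∂_t) = -(N² - |β|²_{g(t)})` (§3.1 (ADM form), p. 21), the quantity whose sign decides whether
  the label lines `t ↦ (t, r, p)` are timelike; with `N ≥ ϑ_*` this reduces their timelikeness on a
  tail to the smallness of `|β|²_{g(t)}` there (not proved here).

* `ADMTailTuple.lemma33_tDeriv_of_supTailNorm_lt_top` — Lemma 3.3 (all six clauses, as proved in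
  `ExteriorTailHolderDecay`: `lemma33_Ioi`) on every slice `t > T̲` of a family with
  `sup_{t > T̲} ‖∂_t^j f(t)‖_{C^{2+α,1+α/2}_{-σ}(M_{r₁,∞})} < ∞` (`r₁ ≥ 0`, `0 < α ≤ 1`), and its class-level
  instances `ADMTailTuple.IsTailCoeff.lemma33_lapseDev` / `.lemma33_gammaDev`: for `𝒮 ∈ 𝒞𝒮_{-τ}(ℳ)`,
  on every fixed tail `r > r₁ > r₀ ≥ 0` and every slice `t > T̲`, `r^τ(N-1)`, `r^τ D̸(N-1)`, `r^τ D̸²(N-1)`,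
  `r^{τ+1} ∂_r N` are bounded and `r^τ D̸²(N-1)`, `r^{τ+1} ∂_r N ∈ C^{α,α/2}` (likewise `r⁻²γ - γ_{S²}`).

Helpers: the summands of `𝒩_τ(r₁)` are finite (`supTailNorm_…_lt_top_of_tailNormN`), a finite
`sup_t` weighted norm bounds every slice (`ctWeightedNorm_tDeriv_zero_le_supTailNorm`), and the
pointwise reading of a weighted sup-norm bound (`norm_le_toReal_mul_rpow_neg`).
No facts; typing consequences of a definition proves nothing about any summit.

## References

* [Ellithy2026] A. Ellithy, arXiv:2605.18730 (2026), §3.1, Def. 3.6 (p. 21), Def. 3.2 and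
  Lemma 3.3 (p. 20).
-/

noncomputable section

set_option maxSynthPendingDepth 3

open Set Metric Function Filter
open scoped ENNReal NNReal Topology RealInnerProductSpace

namespace Literature.Geometry.Lorentzian

variable {W : Type*} [NormedAddCommGroup W] [NormedSpace ℝ W]

/-! ### Reading a weighted sup-norm bound pointwise -/

/-- **Pointwise reading of `‖r^σ v‖_{C⁰(M_J)} ≤ A < ∞`**: `‖v(r, p)‖ ≤ A r^{-σ}` on `J ⊆ (0, ∞)`
(Def. 3.2, p. 20: "decay like `r^{-σ}`"). [cite: Ellithy2026, Def. 3.2 p. 20] -/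
theorem norm_le_toReal_mul_rpow_neg {σ : ℝ} {J : Set ℝ} {v : ℝ → sphere (0 : E3) 1 → W}
    (hJ : J ⊆ Ioi 0) {A : ℝ≥0∞} (hA : A ≠ ⊤) (h : tailSupNorm J (rpowWeight σ v) ≤ A)
    {r : ℝ} (hr : r ∈ J) (p : sphere (0 : E3) 1) : ‖v r p‖ ≤ A.toReal * r ^ (-σ) := by
  have hr0 : 0 < r := hJ hr
  have hle : ‖rpowWeight σ v r p‖ₑ ≤ A := (enorm_le_tailSupNorm J _ hr p).trans h
  have hle' : ‖rpowWeight σ v r p‖ ≤ A.toReal := by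
    rw [← ENNReal.ofReal_le_iff_le_toReal hA, ofReal_norm]
    exact hle
  rw [rpowWeight_apply, norm_smul, Real.norm_eq_abs, abs_of_pos (Real.rpow_pos_of_pos hr0 σ)] at hle'
  have hpos : 0 < r ^ σ := Real.rpow_pos_of_pos hr0 σ
  calc ‖v r p‖ = r ^ (-σ) * (r ^ σ * ‖v r p‖) := by
        rw [Real.rpow_neg hr0.le, ← mul_assoc, inv_mul_cancel₀ hpos.ne', one_mul]
    _ ≤ r ^ (-σ) * A.toReal := mul_le_mul_of_nonneg_left hle' (Real.rpow_nonneg hr0.le _)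
    _ = A.toReal * r ^ (-σ) := mul_comm _ _

namespace ADMTailTuple

/-! ### The summands of `𝒩_τ(r₁)` are finite; a finite `sup_t` bounds every slice -/

section Summands

variable {α σ : ℝ} {Tlo r₁ : ℝ} {f : ℝ → ℝ → sphere (0 : E3) 1 → W}

/-- `∂_t⁰ f(t) = f(t)` on the tail. [cite: Ellithy2026, Def. 3.6 p. 21] -/
@[simp] theorem tDeriv_zero_apply (f : ℝ → ℝ → sphere (0 : E3) 1 → W) (t r : ℝ)
    (p : sphere (0 : E3) 1) : tDeriv 0 f t r p = f t r p := by
  simp [tDeriv]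

/-- A finite `sup_{t > T̲} ‖∂_t^j f(t)‖_{C^{2+α,1+α/2}_{-σ}(M_{r₁,∞})}` bounds the weighted norm of every
slice `t > T̲` (Def. 3.6 (i), p. 21). [cite: Ellithy2026, Def. 3.6 p. 21] -/
theorem ctWeightedNorm_tDeriv_le_supTailNorm {j : ℕ} (h : supTailNorm α σ j Tlo r₁ f < ⊤) {t : ℝ}
    (ht : Tlo < t) : ctWeightedNorm α σ (Ioi r₁) (tDeriv j f t) ≤ supTailNorm α σ j Tlo r₁ f := by
  by_cases hg : TDiffOn j Tlo r₁ f
  · simp only [supTailNorm, hg, if_true]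
    exact le_iSup₂_of_le (f := fun (t : ℝ) (_ : Tlo < t) ↦ ctWeightedNorm α σ (Ioi r₁) (tDeriv j f t))
      t ht le_rfl
  · simp [supTailNorm, hg] at h

end Summands

section Class

variable {S : ADMTailTuple} {α τ Tlo r₀ r₁ : ℝ}

/-- The five `j = 0` summands of `𝒩_τ(r₁)` are finite when `𝒩_τ(r₁)` is (Def. 3.6 (i), p. 21):
`sup_t ‖(N-1)(t)‖`, `sup_t ‖(λ-1)(t)‖`, `sup_t ‖b(t)‖`, `sup_t ‖β(t)‖`, `sup_t ‖(r⁻²γ - γ_{S²})(t)‖` in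
`C^{2+α,1+α/2}_{-τ}(M_{r₁,∞})`. [cite: Ellithy2026, Def. 3.6 p. 21] -/
theorem supTailNorm_zero_lt_top_of_tailNormN (h : S.tailNormN α τ Tlo r₁ < ⊤) :
    supTailNorm α τ 0 Tlo r₁ S.lapseDev < ⊤ ∧ supTailNorm α τ 0 Tlo r₁ S.lamDev < ⊤ ∧
      supTailNorm α τ 0 Tlo r₁ S.b < ⊤ ∧ supTailNorm α τ 0 Tlo r₁ S.shift < ⊤ ∧
      supTailNorm α τ 0 Tlo r₁ S.gammaDev < ⊤ := by
  have h0 : supTailNorm α (τ + (0 : ℕ)) 0 Tlo r₁ S.lapseDev + supTailNorm α (τ + (0 : ℕ)) 0 Tlo r₁ S.lamDev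
      + supTailNorm α (τ + (0 : ℕ)) 0 Tlo r₁ S.b + supTailNorm α (τ + (0 : ℕ)) 0 Tlo r₁ S.shift
      + supTailNorm α (τ + (0 : ℕ)) 0 Tlo r₁ S.gammaDev < ⊤ := by
    refine lt_of_le_of_lt ?_ h
    unfold tailNormN
    exact Finset.single_le_sum (f := fun j : ℕ ↦ supTailNorm α (τ + j) j Tlo r₁ S.lapseDev
        + supTailNorm α (τ + j) j Tlo r₁ S.lamDev + supTailNorm α (τ + j) j Tlo r₁ S.b
        + supTailNorm α (τ + j) j Tlo r₁ S.shift + supTailNorm α (τ + j) j Tlo r₁ S.gammaDev)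
      (fun _ _ ↦ bot_le) (Finset.mem_range.mpr (by norm_num))
  simp only [Nat.cast_zero, add_zero] at h0
  simp only [ENNReal.add_lt_top] at h0
  obtain ⟨⟨⟨⟨h1, h2⟩, h3⟩, h4⟩, h5⟩ := h0
  exact ⟨h1, h2, h3, h4, h5⟩

/-- **Definition 3.6 (ii) unpacked — the lapse**: `ϑ_*⁻¹ ≥ N ≥ ϑ_* > 0` on the tail `r > r₁`, uniformly
in `t > T̲`. [cite: Ellithy2026, Def. 3.6 p. 21] -/
theorem IsTailNondegenerate.lapse_bounds (h : S.IsTailNondegenerate Tlo r₁) :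
    ∃ ϑ : ℝ, 0 < ϑ ∧ ∀ (t r : ℝ) (p : sphere (0 : E3) 1), Tlo < t → r₁ < r →
      ϑ ≤ S.N t r p ∧ S.N t r p ≤ ϑ⁻¹ := by
  obtain ⟨δ, ϑ, c, -, hϑ, -, hall⟩ := h
  refine ⟨ϑ, hϑ, fun t r p ht hr ↦ ?_⟩
  obtain ⟨-, -, h3, h4, h5, -, -⟩ := hall t r p ht hr
  exact ⟨h5, le_trans h4 h3⟩

/-- **Definition 3.6 (ii) unpacked — the radial lapse**: `δ_*⁻¹ ≥ λ ≥ δ_* > 0` on the tail, uniformly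
in `t`. [cite: Ellithy2026, Def. 3.6 p. 21] -/
theorem IsTailNondegenerate.lam_bounds (h : S.IsTailNondegenerate Tlo r₁) :
    ∃ δ : ℝ, 0 < δ ∧ ∀ (t r : ℝ) (p : sphere (0 : E3) 1), Tlo < t → r₁ < r →
      δ ≤ S.lam t r p ∧ S.lam t r p ≤ δ⁻¹ := by
  obtain ⟨δ, ϑ, c, hδ, -, -, hall⟩ := h
  refine ⟨δ, hδ, fun t r p ht hr ↦ ?_⟩
  obtain ⟨h1, h2, -⟩ := hall t r p ht hr
  exact ⟨h2, h1⟩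

/-- **Definition 3.6 (ii) unpacked — the mean curvature**: `c_*⁻¹ ≥ r H_{t,r} ≥ c_* > 0` on the tail,
uniformly in `t`. [cite: Ellithy2026, Def. 3.6 p. 21] -/
theorem IsTailNondegenerate.meanCurv_bounds (h : S.IsTailNondegenerate Tlo r₁) :
    ∃ c : ℝ, 0 < c ∧ ∀ (t r : ℝ) (p : sphere (0 : E3) 1), Tlo < t → r₁ < r →
      c ≤ r * S.meanCurv t r p ∧ r * S.meanCurv t r p ≤ c⁻¹ := by
  obtain ⟨δ, ϑ, c, -, -, hc, hall⟩ := h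
  refine ⟨c, hc, fun t r p ht hr ↦ ?_⟩
  obtain ⟨-, -, -, -, -, h6, h7⟩ := hall t r p ht hr
  exact ⟨h7, h6⟩

/-- Pointwise reading of one finite `j = 0` summand: `‖f(t, r, p)‖ ≤ C r^{-τ}`, uniformly in `t > T̲`,
on `r > r₁ ≥ 0` (Def. 3.6 (i) with Lemma 3.3 / Def. 3.2, pp. 20–21). [cite: Ellithy2026, Def. 3.6 p. 21] -/
theorem norm_le_of_supTailNorm_zero {f : ℝ → ℝ → sphere (0 : E3) 1 → W} (hr₁ : 0 ≤ r₁)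
    (h : supTailNorm α τ 0 Tlo r₁ f < ⊤) {t r : ℝ} (ht : Tlo < t) (hr : r₁ < r)
    (p : sphere (0 : E3) 1) : ‖f t r p‖ ≤ (supTailNorm α τ 0 Tlo r₁ f).toReal * r ^ (-τ) := by
  have hJ : Ioi r₁ ⊆ Ioi (0 : ℝ) := Ioi_subset_Ioi hr₁
  have h1 : tailSupNorm (Ioi r₁) (rpowWeight τ (tDeriv 0 f t)) ≤ supTailNorm α τ 0 Tlo r₁ f :=
    (tailSupNorm_le_ctNorm α (Ioi r₁) _).trans (ctWeightedNorm_tDeriv_le_supTailNorm h ht)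
  have h2 := norm_le_toReal_mul_rpow_neg hJ h.ne h1 (r := r) hr p
  rwa [tDeriv_zero_apply] at h2

/-- **Pointwise, uniform-in-`t` decay on fixed tails for the class `𝒞𝒮_{-τ}(ℳ)`** (Ellithy 2026,
Def. 3.6 (i), p. 21, read through Def. 3.2 / Lemma 3.3, p. 20): for `𝒮 ∈ 𝒞𝒮_{-τ}(ℳ_{T̲, r₀})`,
`r₀ ≥ 0`, and every `r₁ > r₀` there is `C ≥ 0` such that at all `t > T̲`, `r > r₁`, `p ∈ S²`:
`|N - 1| ≤ C r^{-τ}`, `|λ - 1| ≤ C r^{-τ}`, `‖b‖ ≤ C r^{-τ}`, `‖(β_r, β^T)‖ ≤ C r^{-τ}`,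
`‖r⁻²γ(Π·,Π·) - ⟪Π·,Π·⟫‖ ≤ C r^{-τ}`. [cite: Ellithy2026, Def. 3.6 p. 21] -/
theorem IsTailCoeff.pointwise_decay (h : S.IsTailCoeff α τ Tlo r₀) (hr₀ : 0 ≤ r₀) (hr₁ : r₀ < r₁) :
    ∃ C : ℝ, 0 ≤ C ∧ ∀ (t r : ℝ) (p : sphere (0 : E3) 1), Tlo < t → r₁ < r →
      |S.N t r p - 1| ≤ C * r ^ (-τ) ∧ |S.lam t r p - 1| ≤ C * r ^ (-τ) ∧
      ‖S.b t r p‖ ≤ C * r ^ (-τ) ∧ ‖S.shift t r p‖ ≤ C * r ^ (-τ) ∧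
      ‖S.gammaDev t r p‖ ≤ C * r ^ (-τ) := by
  have hr₁0 : 0 ≤ r₁ := hr₀.trans hr₁.le
  obtain ⟨hN, hlam, hb, hshift, hγ⟩ := supTailNorm_zero_lt_top_of_tailNormN (h.tail hr₁).1
  set C := max (max (max (max (supTailNorm α τ 0 Tlo r₁ S.lapseDev).toReal
    (supTailNorm α τ 0 Tlo r₁ S.lamDev).toReal) (supTailNorm α τ 0 Tlo r₁ S.b).toReal)
    (supTailNorm α τ 0 Tlo r₁ S.shift).toReal) (supTailNorm α τ 0 Tlo r₁ S.gammaDev).toReal with hC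
  have hC1 : (supTailNorm α τ 0 Tlo r₁ S.lapseDev).toReal ≤ C := by
    simp only [hC]; exact le_max_of_le_left (le_max_of_le_left (le_max_of_le_left (le_max_left _ _)))
  have hC2 : (supTailNorm α τ 0 Tlo r₁ S.lamDev).toReal ≤ C := by
    simp only [hC]; exact le_max_of_le_left (le_max_of_le_left (le_max_of_le_left (le_max_right _ _)))
  have hC3 : (supTailNorm α τ 0 Tlo r₁ S.b).toReal ≤ C := by
    simp only [hC]; exact le_max_of_le_left (le_max_of_le_left (le_max_right _ _))
  have hC4 : (supTailNorm α τ 0 Tlo r₁ S.shift).toReal ≤ C := by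
    simp only [hC]; exact le_max_of_le_left (le_max_right _ _)
  have hC5 : (supTailNorm α τ 0 Tlo r₁ S.gammaDev).toReal ≤ C := by
    simp only [hC]; exact le_max_right _ _
  refine ⟨C, ENNReal.toReal_nonneg.trans hC1, fun t r p ht hr ↦ ?_⟩
  have hrpos : 0 ≤ r ^ (-τ) := Real.rpow_nonneg (hr₁0.trans hr.le) _
  refine ⟨?_, ?_, ?_, ?_, ?_⟩
  · have := norm_le_of_supTailNorm_zero hr₁0 hN ht hr p
    rw [Real.norm_eq_abs] at this
    exact this.trans (mul_le_mul_of_nonneg_right hC1 hrpos)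
  · have := norm_le_of_supTailNorm_zero hr₁0 hlam ht hr p
    rw [Real.norm_eq_abs] at this
    exact this.trans (mul_le_mul_of_nonneg_right hC2 hrpos)
  · exact (norm_le_of_supTailNorm_zero hr₁0 hb ht hr p).trans (mul_le_mul_of_nonneg_right hC3 hrpos)
  · exact (norm_le_of_supTailNorm_zero hr₁0 hshift ht hr p).trans
      (mul_le_mul_of_nonneg_right hC4 hrpos)
  · exact (norm_le_of_supTailNorm_zero hr₁0 hγ ht hr p).trans (mul_le_mul_of_nonneg_right hC5 hrpos)

/-- From `‖(β_r, β^T)‖ ≤ C r^{-τ}`: both shift components decay (product norm).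
[cite: Ellithy2026, Def. 3.6 p. 21] -/
theorem shift_components_le {C : ℝ} {t r : ℝ} {p : sphere (0 : E3) 1}
    (h : ‖S.shift t r p‖ ≤ C * r ^ (-τ)) :
    |S.βr t r p| ≤ C * r ^ (-τ) ∧ ‖S.βT t r p‖ ≤ C * r ^ (-τ) := by
  have h1 : ‖S.βr t r p‖ ≤ ‖S.shift t r p‖ := norm_fst_le (S.shift t r p)
  have h2 : ‖S.βT t r p‖ ≤ ‖S.shift t r p‖ := norm_snd_le (S.shift t r p)
  exact ⟨(Real.norm_eq_abs _ ▸ h1).trans h, h2.trans h⟩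

end Class

/-! ### Lemma 3.3 on the slices of the class -/

section Lemma33

variable {α σ τ : ℝ} {Tlo r₀ r₁ : ℝ} {f : ℝ → ℝ → sphere (0 : E3) 1 → W} {S : ADMTailTuple}

/-- `∂_t⁰ f(t)` is the slice `f(t)` (as functions on the tail). [cite: Ellithy2026, Def. 3.6 p. 21] -/
theorem tDeriv_zero_eq (f : ℝ → ℝ → sphere (0 : E3) 1 → W) (t : ℝ) : tDeriv 0 f t = f t :=
  funext fun r ↦ funext fun p ↦ tDeriv_zero_apply f t r p

/-- **Lemma 3.3 (Ellithy 2026, p. 20) on every slice of a `sup_t`-finite family**: if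
`sup_{t > T̲} ‖∂_t^j f(t)‖_{C^{2+α,1+α/2}_{-σ}(M_{r₁,∞})} < ∞` (one summand of `𝒩_τ(r₁)`, Def. 3.6 (i),
p. 21; `r₁ ≥ 0`, `0 < α ≤ 1`), then for every `t > T̲` the slice `v := ∂_t^j f(t)` satisfies all six
clauses of Lemma 3.3 on the fixed tail `(r₁, ∞) × S²`: `r^σ v`, `r^σ D̸v`, `r^σ D̸²v`, `r^{σ+1} v_r`
bounded, `r^σ D̸²v`, `r^{σ+1} v_r ∈ C^{α,α/2}`. [cite: Ellithy2026, Lemma 3.3 p. 20; Def. 3.6 p. 21] -/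
theorem lemma33_tDeriv_of_supTailNorm_lt_top {j : ℕ} (hr₁ : 0 ≤ r₁) (hα : 0 < α) (hα1 : α ≤ 1)
    (h : supTailNorm α σ j Tlo r₁ f < ⊤) {t : ℝ} (ht : Tlo < t) :
    tailSupNorm (Ioi r₁) (rpowWeight σ (tDeriv j f t)) < ⊤ ∧
      tailSupNorm (Ioi r₁) (rpowWeight σ (angPart 1 (tDeriv j f t))) < ⊤ ∧
      tailSupNorm (Ioi r₁) (rpowWeight σ (angPart 2 (tDeriv j f t))) < ⊤ ∧
      tailSupNorm (Ioi r₁) (rpowWeight (σ + 1) (rDeriv (tDeriv j f t))) < ⊤ ∧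
      czNorm α (Ioi r₁) (rpowWeight σ (angPart 2 (tDeriv j f t))) < ⊤ ∧
      czNorm α (Ioi r₁) (rpowWeight (σ + 1) (rDeriv (tDeriv j f t))) < ⊤ :=
  lemma33_Ioi hr₁ hα hα1 (lt_of_le_of_lt (ctWeightedNorm_tDeriv_le_supTailNorm h ht) h)

/-- **Lemma 3.3 for the lapse of a tuple of the class** (Ellithy 2026, Def. 3.6 (i) p. 21 with
Lemma 3.3 p. 20): for `𝒮 ∈ 𝒞𝒮_{-τ}(ℳ_{T̲,r₀})`, `r₀ ≥ 0`, `0 < α ≤ 1`, every `r₁ > r₀` and every slice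
`t > T̲`, with `v := (N - 1)(t)` on `(r₁, ∞) × S²`: `r^τ v`, `r^τ D̸v`, `r^τ D̸²v`, `r^{τ+1} ∂_r N` are
bounded and `r^τ D̸²v`, `r^{τ+1} ∂_r N ∈ C^{α,α/2}`. [cite: Ellithy2026, Lemma 3.3 p. 20; Def. 3.6 p. 21] -/
theorem IsTailCoeff.lemma33_lapseDev (h : S.IsTailCoeff α τ Tlo r₀) (hr₀ : 0 ≤ r₀) (hr₁ : r₀ < r₁)
    (hα : 0 < α) (hα1 : α ≤ 1) {t : ℝ} (ht : Tlo < t) :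
    tailSupNorm (Ioi r₁) (rpowWeight τ (S.lapseDev t)) < ⊤ ∧
      tailSupNorm (Ioi r₁) (rpowWeight τ (angPart 1 (S.lapseDev t))) < ⊤ ∧
      tailSupNorm (Ioi r₁) (rpowWeight τ (angPart 2 (S.lapseDev t))) < ⊤ ∧
      tailSupNorm (Ioi r₁) (rpowWeight (τ + 1) (rDeriv (S.lapseDev t))) < ⊤ ∧
      czNorm α (Ioi r₁) (rpowWeight τ (angPart 2 (S.lapseDev t))) < ⊤ ∧
      czNorm α (Ioi r₁) (rpowWeight (τ + 1) (rDeriv (S.lapseDev t))) < ⊤ := by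
  have hfin := (supTailNorm_zero_lt_top_of_tailNormN (h.tail hr₁).1).1
  have key := lemma33_tDeriv_of_supTailNorm_lt_top (hr₀.trans hr₁.le) hα hα1 hfin ht
  rwa [tDeriv_zero_eq] at key

/-- **Lemma 3.3 for the rescaled angular metric of a tuple of the class** (tensor-valued case): for
`𝒮 ∈ 𝒞𝒮_{-τ}(ℳ_{T̲,r₀})`, `r₀ ≥ 0`, `0 < α ≤ 1`, every `r₁ > r₀`, `t > T̲`, with
`v := (r⁻²γ - γ_{S²})(t)`: the six clauses of Lemma 3.3 on `(r₁, ∞) × S²` (Ellithy 2026, p. 20 "tensor-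
valued spaces … components"; Def. 3.6 (i), p. 21). [cite: Ellithy2026, Lemma 3.3 p. 20; Def. 3.6 p. 21] -/
theorem IsTailCoeff.lemma33_gammaDev (h : S.IsTailCoeff α τ Tlo r₀) (hr₀ : 0 ≤ r₀) (hr₁ : r₀ < r₁)
    (hα : 0 < α) (hα1 : α ≤ 1) {t : ℝ} (ht : Tlo < t) :
    tailSupNorm (Ioi r₁) (rpowWeight τ (S.gammaDev t)) < ⊤ ∧
      tailSupNorm (Ioi r₁) (rpowWeight τ (angPart 1 (S.gammaDev t))) < ⊤ ∧
      tailSupNorm (Ioi r₁) (rpowWeight τ (angPart 2 (S.gammaDev t))) < ⊤ ∧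
      tailSupNorm (Ioi r₁) (rpowWeight (τ + 1) (rDeriv (S.gammaDev t))) < ⊤ ∧
      czNorm α (Ioi r₁) (rpowWeight τ (angPart 2 (S.gammaDev t))) < ⊤ ∧
      czNorm α (Ioi r₁) (rpowWeight (τ + 1) (rDeriv (S.gammaDev t))) < ⊤ := by
  have hfin := (supTailNorm_zero_lt_top_of_tailNormN (h.tail hr₁).1).2.2.2.2
  have key := lemma33_tDeriv_of_supTailNorm_lt_top (hr₀.trans hr₁.le) hα hα1 hfin ht
  rwa [tDeriv_zero_eq] at key

end Lemma33

/-! ### The `dt ⊗ dt` coefficient of the ADM form: `g(∂_t, ∂_t) = -(N² - |β|²_{g(t)})` -/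

/-- **`g(∂_t, ∂_t) = -(N² - |β|²_{g(t)})`** — the `dt²` coefficient of the general ADM form
`g = -(N² - |β|²_{g(t)}) dt² + 2 β ⊙ dt + g(t)` (Ellithy 2026, §3.1, p. 21; Def. 4.4 (1), p. 39)
evaluated on the label direction `∂_t = (1, 0)` of the Cartesian slice coordinates.
[cite: Ellithy2026, §3.1 p. 21] -/
theorem admForm_apply_dt_dt (S : ADMTailTuple) (t : ℝ) (y : E3) :
    S.admForm t y ((1 : ℝ), (0 : E3)) ((1 : ℝ), (0 : E3)) =
      -(S.N t ‖y‖ (raySphere y) ^ 2 - S.betaNormSq t y) := by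
  simp [admForm]

/-- Hence a label direction is timelike, `g(∂_t, ∂_t) < 0`, exactly where `|β|²_{g(t)} < N²`
(Ellithy 2026, §3.1, p. 21). [cite: Ellithy2026, §3.1 p. 21] -/
theorem admForm_apply_dt_dt_neg_iff (S : ADMTailTuple) (t : ℝ) (y : E3) :
    S.admForm t y ((1 : ℝ), (0 : E3)) ((1 : ℝ), (0 : E3)) < 0 ↔
      S.betaNormSq t y < S.N t ‖y‖ (raySphere y) ^ 2 := by
  rw [admForm_apply_dt_dt, neg_lt_zero, sub_pos]

end ADMTailTuple

end Literature.Geometry.Lorentzian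

end
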